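import Summits.CriticalPhenomena.Ising3DConformalLimit.Theorems.HyperoctahedralRPExistsScaleCovariantLimitDecimationDefs
import Literature.Probability.LatticeModels.GKSInequalities
import HarnessLib

/-!
# Box bridge: the pair-coupling box average with n.n. couplings IS the free Ising box expectation
(line `decimation-homotopy-rate` of the crux `ExistsScaleCovariantLimit`, item stmt-CriticalPhenomena-1981, route
`HyperoctahedralRP`; registered stub B `stub_boxBridge : Sig.stub_boxBridge`; lead c8, 2026-08-16)

On the box `Λ_N = {-N,…,N}³ ⊆ ℤ³` with free boundary condition and zero field, the pair-coupling Gibbs average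
`PairIsing.gibbsAvg (nnCoupling N β) (boxMonomial N x)` (coupling matrix `β/2` per ORDERED nearest-neighbour
pair of `↥(box 3 N)`, Newman's finite model) equals the tree's finite-volume Ising expectation
`isingExpect (zdGraph 3) (box 3 N) β 0 .free (spinMonomial x)` for every spin monomial all of whose sites lie
in the box. Both are `(∑_τ w(τ) ∏ᵢ τ_{xᵢ}) / ∑_τ w(τ)` with the SAME Boltzmann weight
`w(τ) = exp(β ∑_{{u,v} ∈ ℰ_{Λ_N}} τ_u τ_v)`: `integral_isingMeasure` puts the right-hand side in this form, and
the exponent `∑_a ∑_b c_{ab} τ_a τ_b` of `PairIsing.gibbsWeight` is `β ∑_{edges}` because a nearest-neighbour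
step `b - a = ± eᵢ` is exactly adjacency in `zdGraph 3` (`isNN_sub_iff_adj`) and each edge inside the box is two
ordered pairs (`sum_adj_eq_sum_edgesIn_lift`).

* `stub_boxBridge` — the registered stub B (`Sig.stub_boxBridge = BoxBridge`).
* `gibbsWeight_nnCoupling_eq_isingWeight` — the termwise identity of Boltzmann weights.
* `boxMonomial_eq_spinMonomial_glue` — the termwise identity of observables (sites inside the box).

References: S. Friedli, Y. Velenik, *Statistical Mechanics of Lattice Systems* (CUP 2017), §3.1 eqs. (3.2), (3.7),
(3.8) [FriedliVelenik2017]; C. M. Newman, Comm. Math. Phys. 41 (1975) 1–9, eq. (1.1) [Newman1975]. No definitions,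
no named-fact hypotheses, no `sorry`.
-/

noncomputable section

namespace Summit.CriticalPhenomena.Ising3DConformalLimit.Cruxes.ExistsScaleCovariantLimit.DecimationHomotopyRate

open Literature.Probability.LatticeModels Finset
open scoped BigOperators
open Classical

/-! ## Nearest-neighbour steps versus adjacency, ordered pairs versus edges -/

/-- A nearest-neighbour step `b - a = ± eᵢ` of `ℤ³` is exactly adjacency `a ∼ b` in the n.n. graph `zdGraph 3`
(`zdGraph_adj_iff`: `b = a + eᵢ ∨ a = b + eᵢ`). [folklore] -/
theorem isNN_sub_iff_adj (a b : Site 3) : IsNN (b - a) ↔ (zdGraph 3).Adj a b := by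
  rw [zdGraph_adj_iff, IsNN]
  refine exists_congr fun i => or_congr ?_ ?_
  · rw [sub_eq_iff_eq_add']
  · constructor
    · intro h
      rw [← neg_neg (Pi.single i (1 : ℤ) : Site 3), ← h]
      abel
    · intro h
      rw [h]
      abel

-- adapted from `PairIsing.sum_adj_eq_sum_edgesIn_loc` (Literature/Probability/LatticeModels/TwistCorr.lean),
-- kept out of this file's imports.
/-- Ordered adjacent pairs versus edges: for any `f`,
`Σ_{x ∈ Λ} Σ_{y ∈ Λ, x ∼ y} f(x,y) = Σ_{e = {x,y} ∈ ℰ_Λ} (f(x,y) + f(y,x))` (each edge inside `Λ` is counted once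
with each orientation). [folklore] -/
theorem sum_adj_eq_sum_edgesIn_lift {V : Type*} [DecidableEq V] (G : SimpleGraph V) [DecidableRel G.Adj]
    [G.LocallyFinite] (Λ : Finset V) (f : V → V → ℝ) :
    ∑ x ∈ Λ, ∑ y ∈ Λ.filter (G.Adj x), f x y =
      ∑ e ∈ edgesIn G Λ, Sym2.lift ⟨fun x y => f x y + f y x, fun _ _ => add_comm _ _⟩ e := by
  set D := (Λ ×ˢ Λ).filter (fun p : V × V => G.Adj p.1 p.2) with hD
  have hL : ∑ x ∈ Λ, ∑ y ∈ Λ.filter (G.Adj x), f x y = ∑ p ∈ D, f p.1 p.2 := by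
    rw [hD, sum_filter, sum_product]
    refine sum_congr rfl fun x _ => ?_
    rw [sum_filter]
  have hmaps : ∀ p ∈ D, s(p.1, p.2) ∈ edgesIn G Λ := by
    intro p hp
    rw [hD, mem_filter, mem_product] at hp
    refine mem_edgesIn_iff.2 ⟨(SimpleGraph.mem_edgeSet G).2 hp.2, fun v hv => ?_⟩
    rcases Sym2.mem_iff.1 hv with rfl | rfl
    · exact hp.1.1
    · exact hp.1.2
  rw [hL, ← sum_fiberwise_of_maps_to hmaps]
  refine sum_congr rfl fun e he => ?_
  induction e using Sym2.ind with
  | _ x y =>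
    obtain ⟨hadj, hmem⟩ := mem_edgesIn_iff.1 he
    have hadj' : G.Adj x y := (SimpleGraph.mem_edgeSet G).1 hadj
    have hxy : x ≠ y := G.ne_of_adj hadj'
    have hfib : D.filter (fun p : V × V => s(p.1, p.2) = s(x, y)) = {(x, y), (y, x)} := by
      ext p
      simp only [hD, mem_filter, mem_product, mem_insert, mem_singleton, Sym2.eq_iff]
      constructor
      · rintro ⟨-, ⟨h1, h2⟩ | ⟨h1, h2⟩⟩
        · left; exact Prod.ext h1 h2
        · right; exact Prod.ext h1 h2
      · rintro (rfl | rfl)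
        · exact ⟨⟨⟨hmem x (Sym2.mem_mk_left x y), hmem y (Sym2.mem_mk_right x y)⟩, hadj'⟩,
            Or.inl ⟨rfl, rfl⟩⟩
        · exact ⟨⟨⟨hmem y (Sym2.mem_mk_right x y), hmem x (Sym2.mem_mk_left x y)⟩, hadj'.symm⟩,
            Or.inr ⟨rfl, rfl⟩⟩
    rw [hfib, sum_pair (fun h => hxy (Prod.ext_iff.1 h).1), Sym2.lift_mk]

/-! ## The two termwise identities -/

/-- **The pair-coupling Boltzmann weight of `nnCoupling N β` is the free zero-field Ising weight on the box**:
`exp(∑_a ∑_b c_{ab} τ_a τ_b) = exp(β ∑_{e ∈ ℰ_{Λ_N}} τ_e)` with `c_{ab} = β/2 · 𝟙{b - a = ± eᵢ}` (each edge is two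
ordered pairs). [cite: FriedliVelenik2017, §3.1, eqs. (3.2), (3.7)] -/
theorem gibbsWeight_nnCoupling_eq_isingWeight (N : ℕ) (β : ℝ) (τ : SpinConfig ↥(box 3 N)) :
    PairIsing.gibbsWeight (nnCoupling N β) τ = isingWeight (zdGraph 3) (box 3 N) β 0 .free τ := by
  rw [PairIsing.gibbsWeight, isingWeight]
  congr 1
  simp only [isingHamiltonian, interactionEdges_free, zero_mul, sub_zero, mul_neg, neg_mul, neg_neg]
  set σ : SpinConfig (Site 3) := glue (box 3 N) τ .free with hσ
  have hs : ∀ a : ↥(box 3 N), spinAt a τ = spinAt (a : Site 3) σ := by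
    intro a
    rw [hσ, spinAt_glue_coe]
  have hc : ∀ a b : ↥(box 3 N),
      nnCoupling N β a b = if (zdGraph 3).Adj (a : Site 3) b then β / 2 else 0 := by
    intro a b
    by_cases h : (zdGraph 3).Adj (a : Site 3) b
    · rw [if_pos h]
      exact if_pos ((isNN_sub_iff_adj (a : Site 3) b).2 h)
    · rw [if_neg h]
      exact if_neg (mt (isNN_sub_iff_adj (a : Site 3) b).1 h)
  simp_rw [hs, hc]
  set g : Site 3 → Site 3 → ℝ :=
    fun x y => (if (zdGraph 3).Adj x y then β / 2 else 0) * (spinAt x σ * spinAt y σ) with hg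
  calc ∑ a : ↥(box 3 N), ∑ b : ↥(box 3 N), g a b = ∑ a : ↥(box 3 N), ∑ y ∈ box 3 N, g a y :=
        Finset.sum_congr rfl fun a _ => Finset.sum_coe_sort (box 3 N) (g a)
    _ = ∑ x ∈ box 3 N, ∑ y ∈ box 3 N, g x y := Finset.sum_coe_sort (box 3 N) (fun x => ∑ y ∈ box 3 N, g x y)
    _ = ∑ x ∈ box 3 N, ∑ y ∈ (box 3 N).filter ((zdGraph 3).Adj x), β / 2 * (spinAt x σ * spinAt y σ) := by
        refine Finset.sum_congr rfl fun x _ => ?_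
        rw [Finset.sum_filter]
        refine Finset.sum_congr rfl fun y _ => ?_
        simp only [hg]
        split_ifs <;> simp
    _ = ∑ e ∈ edgesIn (zdGraph 3) (box 3 N), β * bondSpin σ e := by
        rw [sum_adj_eq_sum_edgesIn_lift (zdGraph 3) (box 3 N)]
        refine Finset.sum_congr rfl fun e _ => ?_
        induction e using Sym2.ind with
        | _ x y => rw [Sym2.lift_mk, bondSpin_mk]; ring
    _ = β * ∑ e ∈ edgesIn (zdGraph 3) (box 3 N), bondSpin σ e := (Finset.mul_sum _ _ _).symm

/-- **Inside the box the box monomial is the spin monomial of the glued configuration**: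
`boxMonomial N x τ = ∏ᵢ (glue Λ_N τ free)_{xᵢ}` when every `xᵢ ∈ Λ_N` (the free outside is never read).
[cite: FriedliVelenik2017, §3.1] -/
theorem boxMonomial_eq_spinMonomial_glue (N : ℕ) {n : ℕ} {x : Fin n → Site 3} (hx : ∀ i, x i ∈ box 3 N)
    (τ : SpinConfig ↥(box 3 N)) : boxMonomial N x τ = spinMonomial x (glue (box 3 N) τ .free) := by
  unfold boxMonomial spinMonomial
  refine Finset.prod_congr rfl fun i _ => ?_
  rw [dif_pos (hx i), spinAt_glue_of_mem τ .free (hx i)]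

/-! ## The registered stub -/

/-- **B — BOX BRIDGE (registered stub `stub_boxBridge` of line `decimation-homotopy-rate`).** On the box `Λ_N`
with free boundary condition and zero field, for every spin monomial whose sites all lie in the box,
`PairIsing.gibbsAvg (nnCoupling N β) (boxMonomial N x) = isingExpect (zdGraph 3) (box 3 N) β 0 .free (spinMonomial x)`:
both sides are `(∑_τ w(τ) ∏ᵢ τ_{xᵢ}) / ∑_τ w(τ)` with the same Boltzmann weight (`integral_isingMeasure`,
`gibbsWeight_nnCoupling_eq_isingWeight`, `boxMonomial_eq_spinMonomial_glue`).
[cite: FriedliVelenik2017, §3.1, eq. (3.8)] -/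
theorem stub_boxBridge : Sig.stub_boxBridge := by
  intro N β n x hx
  have hnum : ∑ ρ, boxMonomial N x ρ * PairIsing.gibbsWeight (nnCoupling N β) ρ =
      ∑ τ : SpinConfig ↥(box 3 N), isingWeight (zdGraph 3) (box 3 N) β 0 .free τ *
        spinMonomial x (glue (box 3 N) τ .free) :=
    Finset.sum_congr rfl fun τ _ => by
      rw [gibbsWeight_nnCoupling_eq_isingWeight, boxMonomial_eq_spinMonomial_glue N hx, mul_comm]
  have hden : ∑ ρ, PairIsing.gibbsWeight (nnCoupling N β) ρ =
      isingPartitionFunction (zdGraph 3) (box 3 N) β 0 .free :=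
    Finset.sum_congr rfl fun τ _ => gibbsWeight_nnCoupling_eq_isingWeight N β τ
  rw [PairIsing.gibbsAvg_def, hnum, hden, isingExpect,
    integral_isingMeasure (zdGraph 3) (box 3 N) β 0 .free (measurable_spinMonomial x)]

end Summit.CriticalPhenomena.Ising3DConformalLimit.Cruxes.ExistsScaleCovariantLimit.DecimationHomotopyRate

end
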